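import Summits.QuantumFields.YangMills.Theorems.BalabanUVNodesPortS1Sect4AtRecordPkg

/-!
# NODE O port, row PT-A-2 S4 — THE ONE-NAME §4 PACKAGE AT THE RECORD FROM ROWS: FORMAT⁺ᴳ at level `k` + token [12] (the `C⁴` row, FILE `…Sect4ChartSmooth`) + the free-radius domain
# rows `νD` (the `hN` row, FILE `…Sect5OnDomainF1Perm`) ⟹ (4.15)₂, p. 289, (4.15)₃, (4.29) EXACT, (4.31) EXACT and the scalar-kernel Hessian under ONE `eV`, at the volume `recordK₀ F Mc k + n`

CITATION HEADER.  [I] = [Balaban1987RG1]: (1.6)–(1.7) p. 261, (1.18)–(1.19) p. 263, (4.15) p. 284, (4.29) p. 288, (4.31) p. 289, (4.32)–(4.34) p. 289, (2.16) p. 269; [15] = [Balaban1985Variational]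
Prop. 9 p. 309, Thm 1 p. 279.  Porter PT-A-2 (`ymgap-nodeO-port-PTA-2`), `--supports stmt-QuantumFields-27930 --as helper`.  REUSED BY NAME: `sect4_recordTermsAx_package`,
`contDiffAt_expChart_recordTermsAx_of_formatPlusG`, `mergedTermT_gaugeAct_recordAx_of_rows'`.
WHAT IS PROVED (0 sorry, 0 def): ★★★ `sect4_recordTermsAx_of_formatPlusG_rows'` — the S4 counterpart of `sect5_recordPlimAx_of_formatPlusG_rows'`.  DISPLAYED ROWS: FORMAT⁺ᴳ(k) (radii `α₀, α₁ > 0`),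
token [12]'s shape, `0 < νD.ε₀`, `k + 1 ≤ K`, [B11] E+U at radius `a₀` on `{PlaqSmall νD.ε₀}` (levels ≤ k+1), (F7a), (F7a-supp), (I19), the top nesting + [B11] at radius `εbg = a₀` — at
the one volume `K = recordK₀ F Mc k + n`.  ORDER NOTE: for the EARLIER levels (where §4 acts in print) FORMAT⁺ᴳ is the induction hypothesis; at the current level the `C⁴` row is the
step's own analyticity output.
HONEST FRAMING.  One composition; nothing of Bałaban's estimates asserted, ported or discharged; 27930 signed-open (⁸-Ax-LR4), no claim held; finite 𝕋⁴ at fixed ε — NOT continuum∕OS∕Clay;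
the Yang–Mills mass gap is NOT proved by any of this.
-/

noncomputable section

open scoped Matrix.Norms.L2Operator Topology

namespace Summit.QuantumFields.YangMills.Theorems.BalabanUVNodesPortS1

open Filter Matrix MeasureTheory
open NormedSpace (exp)
open Literature.Algebra.Lie.CompactKillingForm (su mem_su_iff)
open Literature.MathematicalPhysics.QuantumFieldTheory.Balaban1983to89
open Literature.MathematicalPhysics.QuantumFieldTheory.Balaban1983to89.Node00
open Literature.MathematicalPhysics.QuantumFieldTheory.Balaban1983to89.ExpMeanLog (deltaSU)
open Literature.MathematicalPhysics.QuantumFieldTheory.GawedzkiKupiainen1985.PeriodicGleason (unitVec)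
open T4Continuum (T4Family)
open Summit.QuantumFields.YangMills.Theorems.K0RecordFormatNames
open Literature.MathematicalPhysics.QuantumFieldTheory.Balaban1983to89.B12PolarizationTensor120 (expChart expChart_apply)
open FederbushMean (deltaFed)
open GaugeField (gaugeAct)

variable (F : T4Family) (a₀ ε₂₉ : ℝ) (νD : Stage7Numerics)

-- (the quadruply nested operator space over the iterated `Pi` type: one more level of pending instance synthesis)
set_option maxSynthPendingDepth 3 in
/-- **★★★ THE §4 PACKAGE AT THE RECORD FROM FORMAT⁺ᴳ + [12] + THE νD-ROWS** (volume `K = recordK₀ F Mc k + n`, history `v`): the six identities of `sect4_recordTermsAx_package` under one `eV`, with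
`C⁴ at 0` supplied by `contDiffAt_expChart_recordTermsAx_of_formatPlusG` and `hN` by `mergedTermT_gaugeAct_recordAx_of_rows'` at `ε₁ := νD.ε₀`.
[cite: Balaban1987RG1, (4.15) p.284, (4.29) p.288, (4.31) p.289, (4.32)-(4.34) p.289, (1.6)-(1.7) p.261, (1.18)-(1.19) p.263, (2.16) p.269; Balaban1985Variational, Prop. 9 p.309] -/
theorem sect4_recordTermsAx_of_formatPlusG_rows' (Mc k n : ℕ) (v : Fin (k + 1) → ℝ) {α₀ α₁ E₀ κ : ℝ} (hα₀ : 0 < α₀) (hα₁ : 0 < α₁) (hε₀ : 0 < νD.ε₀)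
    (hF : letI θ := thetaFill F a₀ ε₂₉; letI := θ.instVβ₁; letI := θ.instVβ₂; letI := θ.instιβ;
      B12FormatPlus.FormatPlusG (fun n => recordDomSys F Mc k (recordK₀ F Mc k + n)) (fun n => recordBondCount F (recordK₀ F Mc k + n))
        (fun n => recordAct F (recordK₀ F Mc k + n)) (fun n => recordUc F Mc k α₀ α₁ (recordK₀ F Mc k + n)) (fun n => recordCoords F Mc k (recordK₀ F Mc k + n))
        (fun n => recordChartDimJ F (recordK₀ F Mc k + n)) (fun n => recordChartJ F Mc k (recordK₀ F Mc k + n))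
        (fun n => recordΦfAx F a₀ ε₂₉ k v (recordK₀ F Mc k + n)) (fun n => recordEmbJ F θ k (recordK₀ F Mc k + n))
        (fun n => recordWrapCtr F Mc k (recordK₀ F Mc k + n)) (fun n => recordDomEmbCtr F Mc k (recordK₀ F Mc k + n))
        (fun n _ => recordCoordProjCtr F (recordK₀ F Mc k + n)) E₀ κ)
    (hreg : letI θ := thetaFill F a₀ ε₂₉; letI := θ.instVβ₁; letI := θ.instVβ₂; letI := θ.instιβ;
      ∀ n : ℕ, AnalyticAt ℝ (fun B : recordW F a₀ ε₂₉ k (recordK₀ F Mc k + n) =>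
        fun (b : PBond (F.P (recordK₀ F Mc k + n)) 0) (i i' : Fin 2) =>
          ((recordBgField F θ k (recordK₀ F Mc k + n) B b : SU 2) : Matrix (Fin 2) (Fin 2) ℂ) i i') 0)
    (hk : k + 1 ≤ recordK₀ F Mc k + n)
    (h11 : letI θ := thetaFill F a₀ ε₂₉
      ∀ j < k + 1, ∀ W ∈ domAltOfRecord F 2 νD (recordK₀ F Mc k + n) (j + 1),
        UkExists F 2 (recordK₀ F Mc k + n) (j + 1) θ.ν.εreg W ∧ UniqueUkOrbit F 2 (recordK₀ F Mc k + n) (j + 1) θ.ν.εreg W)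
    (hF7a : letI θ := thetaFill F a₀ ε₂₉
      ∀ j < k + 1, domAltOfRecord F 2 νD (recordK₀ F Mc k + n) (j + 1) ⊆
        regSetOfRecord F 2 (recordK₀ F Mc k + n) j (betaInputOfRecord F 2 (TβOfRecord₁₃ F 2) (chiβOfRecord₁₃Ax F 2 θ) (recordK₀ F Mc k + n) (T4FlagMemory.extd v) j))
    (hsupp : letI θ := thetaFill F a₀ ε₂₉
      ∀ j < k + 1, ∀ᵐ U ∂(fieldMeasure (F.P (recordK₀ F Mc k + n)) j (SU 2)), (avOfRecord F 2 (recordK₀ F Mc k + n) j).avg U ∈ domAltOfRecord F 2 νD (recordK₀ F Mc k + n) (j + 1) →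
        U ∉ domAltOfRecord F 2 νD (recordK₀ F Mc k + n) j → chiβOfRecord₁₃Ax F 2 θ (recordK₀ F Mc k + n) (T4FlagMemory.extd v) j U = 0)
    (hint : letI θ := thetaFill F a₀ ε₂₉
      ∀ j < k + 1, Integrable (betaInputOfRecord F 2 (TβOfRecord₁₃ F 2) (chiβOfRecord₁₃Ax F 2 θ) (recordK₀ F Mc k + n) (T4FlagMemory.extd v) j)
        (fieldMeasure (F.P (recordK₀ F Mc k + n)) j (SU 2)))
    (htop : letI θ := thetaFill F a₀ ε₂₉
      ∀ W ∈ domAltOfRecord F 2 νD (recordK₀ F Mc k + n) (k + 1),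
        Averaging.iter (avOfRecord F 2 (recordK₀ F Mc k + n)) k (Uk F 2 (recordK₀ F Mc k + n) (k + 1) θ.εbg W) ∈ domAltOfRecord F 2 νD (recordK₀ F Mc k + n) k ∧
          UkExists F 2 (recordK₀ F Mc k + n) (k + 1) θ.εbg W ∧ UniqueUkOrbit F 2 (recordK₀ F Mc k + n) (k + 1) θ.εbg W) :
    letI θ := thetaFill F a₀ ε₂₉
    letI := θ.instVβ₁; letI := θ.instVβ₂
    ∃ eV : θ.Vβ ≃ₗ[ℝ] su (Fin 2), (∀ a, ((eV a : su (Fin 2)) : Matrix (Fin 2) (Fin 2) ℂ) = θ.ρ8 a) ∧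
      (∀ a b : θ.Vβ, θ.ρ8 (eV.symm ⁅eV a, eV b⁆) = θ.ρ8 a * θ.ρ8 b - θ.ρ8 b * θ.ρ8 a) ∧
      -- (4.15)₂
      (∀ (u w : recordW F a₀ ε₂₉ k (recordK₀ F Mc k + n)) (lam : Site (F.P (recordK₀ F Mc k + n)) (k + 1) → θ.Vβ),
        fderiv ℝ (fderiv ℝ (fderiv ℝ (expChart (recordTermsAx F a₀ ε₂₉ k v (recordK₀ F Mc k + n)) θ.ρ8))) 0 u w (fun ν y => lam (y + siteOfInt F (recordK₀ F Mc k + n) (k + 1) (unitVec (Fin.cast (F.P_d (recordK₀ F Mc k + n)) ν))) - lam y)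
          - fderiv ℝ (fderiv ℝ (expChart (recordTermsAx F a₀ ε₂₉ k v (recordK₀ F Mc k + n)) θ.ρ8)) 0 u
              (fun ν x => eV.symm ⁅eV (lam x), eV (w ν x)⁆ - (2 : ℝ)⁻¹ • eV.symm ⁅eV (w ν x), eV (lam (x + siteOfInt F (recordK₀ F Mc k + n) (k + 1) (unitVec (Fin.cast (F.P_d (recordK₀ F Mc k + n)) ν))) - lam x)⁆)
          - fderiv ℝ (fderiv ℝ (expChart (recordTermsAx F a₀ ε₂₉ k v (recordK₀ F Mc k + n)) θ.ρ8)) 0 w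
              (fun ν x => eV.symm ⁅eV (lam x), eV (u ν x)⁆ - (2 : ℝ)⁻¹ • eV.symm ⁅eV (u ν x), eV (lam (x + siteOfInt F (recordK₀ F Mc k + n) (k + 1) (unitVec (Fin.cast (F.P_d (recordK₀ F Mc k + n)) ν))) - lam x)⁆) = 0) ∧
      -- p. 289 `Ad`-invariance
      (∀ (l : θ.Vβ) (u w : recordW F a₀ ε₂₉ k (recordK₀ F Mc k + n)),
        fderiv ℝ (fderiv ℝ (expChart (recordTermsAx F a₀ ε₂₉ k v (recordK₀ F Mc k + n)) θ.ρ8)) 0 u (fun ν x => eV.symm ⁅eV l, eV (w ν x)⁆) +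
          fderiv ℝ (fderiv ℝ (expChart (recordTermsAx F a₀ ε₂₉ k v (recordK₀ F Mc k + n)) θ.ρ8)) 0 w (fun ν x => eV.symm ⁅eV l, eV (u ν x)⁆) = 0) ∧
      -- (4.15)₃
      (∀ (u₁ u₂ u₃ : recordW F a₀ ε₂₉ k (recordK₀ F Mc k + n)) (lam : Site (F.P (recordK₀ F Mc k + n)) (k + 1) → θ.Vβ),
        fderiv ℝ (fderiv ℝ (fderiv ℝ (fderiv ℝ (expChart (recordTermsAx F a₀ ε₂₉ k v (recordK₀ F Mc k + n)) θ.ρ8)))) 0 u₁ u₂ u₃ (fun ν y => lam (y + siteOfInt F (recordK₀ F Mc k + n) (k + 1) (unitVec (Fin.cast (F.P_d (recordK₀ F Mc k + n)) ν))) - lam y)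
          - fderiv ℝ (fderiv ℝ (fderiv ℝ (expChart (recordTermsAx F a₀ ε₂₉ k v (recordK₀ F Mc k + n)) θ.ρ8))) 0 u₁ u₂
              (fun ν x => eV.symm ⁅eV (lam x), eV (u₃ ν x)⁆ - (2 : ℝ)⁻¹ • eV.symm ⁅eV (u₃ ν x), eV (lam (x + siteOfInt F (recordK₀ F Mc k + n) (k + 1) (unitVec (Fin.cast (F.P_d (recordK₀ F Mc k + n)) ν))) - lam x)⁆)
          - fderiv ℝ (fderiv ℝ (fderiv ℝ (expChart (recordTermsAx F a₀ ε₂₉ k v (recordK₀ F Mc k + n)) θ.ρ8))) 0 u₁ u₃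
              (fun ν x => eV.symm ⁅eV (lam x), eV (u₂ ν x)⁆ - (2 : ℝ)⁻¹ • eV.symm ⁅eV (u₂ ν x), eV (lam (x + siteOfInt F (recordK₀ F Mc k + n) (k + 1) (unitVec (Fin.cast (F.P_d (recordK₀ F Mc k + n)) ν))) - lam x)⁆)
          - fderiv ℝ (fderiv ℝ (fderiv ℝ (expChart (recordTermsAx F a₀ ε₂₉ k v (recordK₀ F Mc k + n)) θ.ρ8))) 0 u₂ u₃
              (fun ν x => eV.symm ⁅eV (lam x), eV (u₁ ν x)⁆ - (2 : ℝ)⁻¹ • eV.symm ⁅eV (u₁ ν x), eV (lam (x + siteOfInt F (recordK₀ F Mc k + n) (k + 1) (unitVec (Fin.cast (F.P_d (recordK₀ F Mc k + n)) ν))) - lam x)⁆)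
          + fderiv ℝ (fderiv ℝ (expChart (recordTermsAx F a₀ ε₂₉ k v (recordK₀ F Mc k + n)) θ.ρ8)) 0 u₁
              (fun ν x => (12 : ℝ)⁻¹ • (eV.symm ⁅eV (u₂ ν x), eV (eV.symm ⁅eV (u₃ ν x), eV (lam (x + siteOfInt F (recordK₀ F Mc k + n) (k + 1) (unitVec (Fin.cast (F.P_d (recordK₀ F Mc k + n)) ν))) - lam x)⁆)⁆ +
                eV.symm ⁅eV (u₃ ν x), eV (eV.symm ⁅eV (u₂ ν x), eV (lam (x + siteOfInt F (recordK₀ F Mc k + n) (k + 1) (unitVec (Fin.cast (F.P_d (recordK₀ F Mc k + n)) ν))) - lam x)⁆)⁆))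
          + fderiv ℝ (fderiv ℝ (expChart (recordTermsAx F a₀ ε₂₉ k v (recordK₀ F Mc k + n)) θ.ρ8)) 0 u₂
              (fun ν x => (12 : ℝ)⁻¹ • (eV.symm ⁅eV (u₁ ν x), eV (eV.symm ⁅eV (u₃ ν x), eV (lam (x + siteOfInt F (recordK₀ F Mc k + n) (k + 1) (unitVec (Fin.cast (F.P_d (recordK₀ F Mc k + n)) ν))) - lam x)⁆)⁆ +
                eV.symm ⁅eV (u₃ ν x), eV (eV.symm ⁅eV (u₁ ν x), eV (lam (x + siteOfInt F (recordK₀ F Mc k + n) (k + 1) (unitVec (Fin.cast (F.P_d (recordK₀ F Mc k + n)) ν))) - lam x)⁆)⁆))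
          + fderiv ℝ (fderiv ℝ (expChart (recordTermsAx F a₀ ε₂₉ k v (recordK₀ F Mc k + n)) θ.ρ8)) 0 u₃
              (fun ν x => (12 : ℝ)⁻¹ • (eV.symm ⁅eV (u₁ ν x), eV (eV.symm ⁅eV (u₂ ν x), eV (lam (x + siteOfInt F (recordK₀ F Mc k + n) (k + 1) (unitVec (Fin.cast (F.P_d (recordK₀ F Mc k + n)) ν))) - lam x)⁆)⁆ +
                eV.symm ⁅eV (u₂ ν x), eV (eV.symm ⁅eV (u₁ ν x), eV (lam (x + siteOfInt F (recordK₀ F Mc k + n) (k + 1) (unitVec (Fin.cast (F.P_d (recordK₀ F Mc k + n)) ν))) - lam x)⁆)⁆)) = 0) ∧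
      -- (4.29) EXACT
      (∀ (x : Site (F.P (recordK₀ F Mc k + n)) (k + 1)) (lam : Site (F.P (recordK₀ F Mc k + n)) (k + 1) → θ.Vβ), lam x = 0 → ∀ (δ c B : recordW F a₀ ε₂₉ k (recordK₀ F Mc k + n)),
        (∀ ν y, y ≠ x → δ ν y = 0) → (∀ ν y, lam (y + siteOfInt F (recordK₀ F Mc k + n) (k + 1) (unitVec (Fin.cast (F.P_d (recordK₀ F Mc k + n)) ν))) - lam y = c ν y) → (∀ ν, B ν x = c ν x) →
        fderiv ℝ (fderiv ℝ (fderiv ℝ (fderiv ℝ (expChart (recordTermsAx F a₀ ε₂₉ k v (recordK₀ F Mc k + n)) θ.ρ8)))) 0 δ B B B =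
          (2 : ℝ) • fderiv ℝ (fderiv ℝ (expChart (recordTermsAx F a₀ ε₂₉ k v (recordK₀ F Mc k + n)) θ.ρ8)) 0 δ (fun ν y => eV.symm ⁅eV (lam y), eV (eV.symm ⁅eV (lam y), eV (c ν y)⁆)⁆)
          - fderiv ℝ (fderiv ℝ (expChart (recordTermsAx F a₀ ε₂₉ k v (recordK₀ F Mc k + n)) θ.ρ8)) 0 δ (fun ν y => eV.symm ⁅eV (eV.symm ⁅eV (lam y), eV (c ν y)⁆), eV (c ν y)⁆)
          - (3 / 2 : ℝ) • fderiv ℝ (fderiv ℝ (expChart (recordTermsAx F a₀ ε₂₉ k v (recordK₀ F Mc k + n)) θ.ρ8)) 0 (fun ν y => eV.symm ⁅eV (δ ν y), eV (B ν y)⁆) (fun ν y => eV.symm ⁅eV (lam y), eV (c ν y)⁆)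
          + (fderiv ℝ (fderiv ℝ (fderiv ℝ (fderiv ℝ (expChart (recordTermsAx F a₀ ε₂₉ k v (recordK₀ F Mc k + n)) θ.ρ8)))) 0 δ B B (B - c)
            - (2 : ℝ) • fderiv ℝ (fderiv ℝ (expChart (recordTermsAx F a₀ ε₂₉ k v (recordK₀ F Mc k + n)) θ.ρ8)) 0
                (fun ν y => (12 : ℝ)⁻¹ • (eV.symm ⁅eV (B ν y), eV (eV.symm ⁅eV (δ ν y), eV (c ν y)⁆)⁆ + eV.symm ⁅eV (δ ν y), eV (eV.symm ⁅eV (B ν y), eV (c ν y)⁆)⁆)) (B - c)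
            - (2 : ℝ) • fderiv ℝ (fderiv ℝ (expChart (recordTermsAx F a₀ ε₂₉ k v (recordK₀ F Mc k + n)) θ.ρ8)) 0 δ (fun ν y => (12 : ℝ)⁻¹ • eV.symm ⁅eV (B ν y), eV (eV.symm ⁅eV (B ν y - c ν y), eV (c ν y)⁆)⁆)
            - (2 : ℝ)⁻¹ • fderiv ℝ (fderiv ℝ (fderiv ℝ (expChart (recordTermsAx F a₀ ε₂₉ k v (recordK₀ F Mc k + n)) θ.ρ8))) 0 (fun ν y => eV.symm ⁅eV (δ ν y), eV (B ν y)⁆) B (B - c)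
            + (4 : ℝ)⁻¹ • fderiv ℝ (fderiv ℝ (expChart (recordTermsAx F a₀ ε₂₉ k v (recordK₀ F Mc k + n)) θ.ρ8)) 0 (fun ν y => eV.symm ⁅eV (δ ν y), eV (B ν y)⁆) (fun ν y => eV.symm ⁅eV (B ν y - c ν y), eV (c ν y)⁆)
            + (4 : ℝ)⁻¹ • fderiv ℝ (fderiv ℝ (expChart (recordTermsAx F a₀ ε₂₉ k v (recordK₀ F Mc k + n)) θ.ρ8)) 0 (fun ν y => eV.symm ⁅eV (eV.symm ⁅eV (δ ν y), eV (B ν y)⁆), eV (B ν y)⁆) (B - c)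
            - fderiv ℝ (fderiv ℝ (fderiv ℝ (expChart (recordTermsAx F a₀ ε₂₉ k v (recordK₀ F Mc k + n)) θ.ρ8))) 0 δ B (fun ν y => eV.symm ⁅eV (B ν y - c ν y), eV (c ν y)⁆)
            + (2 : ℝ) • fderiv ℝ (fderiv ℝ (fderiv ℝ (expChart (recordTermsAx F a₀ ε₂₉ k v (recordK₀ F Mc k + n)) θ.ρ8))) 0 δ (fun ν y => eV.symm ⁅eV (lam y), eV (B ν y)⁆) (B - c)
            + (2 : ℝ) • fderiv ℝ (fderiv ℝ (expChart (recordTermsAx F a₀ ε₂₉ k v (recordK₀ F Mc k + n)) θ.ρ8)) 0 δ (fun ν y => eV.symm ⁅eV (lam y), eV (eV.symm ⁅eV (lam y), eV (B ν y - c ν y)⁆)⁆)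
            - fderiv ℝ (fderiv ℝ (expChart (recordTermsAx F a₀ ε₂₉ k v (recordK₀ F Mc k + n)) θ.ρ8)) 0 δ (fun ν y => eV.symm ⁅eV (eV.symm ⁅eV (lam y), eV (B ν y - c ν y)⁆), eV (c ν y)⁆)
            - (3 / 2 : ℝ) • fderiv ℝ (fderiv ℝ (expChart (recordTermsAx F a₀ ε₂₉ k v (recordK₀ F Mc k + n)) θ.ρ8)) 0 (fun ν y => eV.symm ⁅eV (δ ν y), eV (B ν y)⁆) (fun ν y => eV.symm ⁅eV (lam y), eV (B ν y - c ν y)⁆))) ∧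
      -- (4.31) EXACT
      (∀ (x : Site (F.P (recordK₀ F Mc k + n)) (k + 1)) (lam : Site (F.P (recordK₀ F Mc k + n)) (k + 1) → θ.Vβ), lam x = 0 → ∀ (δ c B ℓ : recordW F a₀ ε₂₉ k (recordK₀ F Mc k + n)),
        (∀ ν y, y ≠ x → δ ν y = 0) → (∀ ν y, lam (y + siteOfInt F (recordK₀ F Mc k + n) (k + 1) (unitVec (Fin.cast (F.P_d (recordK₀ F Mc k + n)) ν))) - lam y = c ν y) → (∀ ν, B ν x = c ν x) →
        fderiv ℝ (fderiv ℝ (fderiv ℝ (expChart (recordTermsAx F a₀ ε₂₉ k v (recordK₀ F Mc k + n)) θ.ρ8))) 0 δ B B =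
          fderiv ℝ (fderiv ℝ (expChart (recordTermsAx F a₀ ε₂₉ k v (recordK₀ F Mc k + n)) θ.ρ8)) 0 δ (fun ν y => eV.symm ⁅eV (lam y), eV (c ν y)⁆)
          + (2 : ℝ) • fderiv ℝ (fderiv ℝ (expChart (recordTermsAx F a₀ ε₂₉ k v (recordK₀ F Mc k + n)) θ.ρ8)) 0 δ (fun ν y => eV.symm ⁅eV (lam y), eV (ℓ ν y)⁆)
          - fderiv ℝ (fderiv ℝ (expChart (recordTermsAx F a₀ ε₂₉ k v (recordK₀ F Mc k + n)) θ.ρ8)) 0 δ (fun ν y => eV.symm ⁅eV (ℓ ν y), eV (c ν y)⁆)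
          - fderiv ℝ (fderiv ℝ (expChart (recordTermsAx F a₀ ε₂₉ k v (recordK₀ F Mc k + n)) θ.ρ8)) 0 (fun ν y => eV.symm ⁅eV (δ ν y), eV (B ν y)⁆) ℓ
          + (fderiv ℝ (fderiv ℝ (fderiv ℝ (expChart (recordTermsAx F a₀ ε₂₉ k v (recordK₀ F Mc k + n)) θ.ρ8))) 0 δ B (B - c - ℓ)
            + fderiv ℝ (fderiv ℝ (fderiv ℝ (expChart (recordTermsAx F a₀ ε₂₉ k v (recordK₀ F Mc k + n)) θ.ρ8))) 0 δ ℓ ℓ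
            + fderiv ℝ (fderiv ℝ (fderiv ℝ (expChart (recordTermsAx F a₀ ε₂₉ k v (recordK₀ F Mc k + n)) θ.ρ8))) 0 δ (B - c - ℓ) ℓ
            - (2 : ℝ)⁻¹ • fderiv ℝ (fderiv ℝ (expChart (recordTermsAx F a₀ ε₂₉ k v (recordK₀ F Mc k + n)) θ.ρ8)) 0 (fun ν y => eV.symm ⁅eV (δ ν y), eV (B ν y)⁆) (B - c - ℓ)
            + fderiv ℝ (fderiv ℝ (expChart (recordTermsAx F a₀ ε₂₉ k v (recordK₀ F Mc k + n)) θ.ρ8)) 0 δ (fun ν y => eV.symm ⁅eV (lam y), eV (B ν y - c ν y - ℓ ν y)⁆)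
            - (2 : ℝ)⁻¹ • fderiv ℝ (fderiv ℝ (expChart (recordTermsAx F a₀ ε₂₉ k v (recordK₀ F Mc k + n)) θ.ρ8)) 0 δ (fun ν y => eV.symm ⁅eV (B ν y - c ν y - ℓ ν y), eV (c ν y)⁆))) ∧
      -- (4.32)–(4.34): one scalar kernel
      (∃ E : Fin (F.P (recordK₀ F Mc k + n)).d → Site (F.P (recordK₀ F Mc k + n)) (k + 1) → Fin (F.P (recordK₀ F Mc k + n)).d → Site (F.P (recordK₀ F Mc k + n)) (k + 1) → ℝ, ∀ u w : recordW F a₀ ε₂₉ k (recordK₀ F Mc k + n),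
        fderiv ℝ (fderiv ℝ (expChart (recordTermsAx F a₀ ε₂₉ k v (recordK₀ F Mc k + n)) θ.ρ8)) 0 u w = ∑ μ, ∑ x, ∑ ν, ∑ y, killingForm ℝ (su (Fin 2)) (eV (u μ x)) (eV (w ν y)) • E μ x ν y) := by
  letI θ := thetaFill F a₀ ε₂₉; letI := θ.instVβ₁; letI := θ.instVβ₂; letI := θ.instιβ
  exact sect4_recordTermsAx_package F a₀ ε₂₉ k v (recordK₀ F Mc k + n) hε₀
    (contDiffAt_expChart_recordTermsAx_of_formatPlusG F a₀ ε₂₉ Mc k v hα₀ hα₁ hF hreg n 4)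
    (fun w W hW => mergedTermT_gaugeAct_recordAx_of_rows' F θ νD θ.εbg (recordK₀ F Mc k + n) (T4FlagMemory.extd v) hk h11 hF7a hsupp hint htop w W hW)

end Summit.QuantumFields.YangMills.Theorems.BalabanUVNodesPortS1

end
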